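import Literature.Combinatorics.StablePolynomials.BoundedDegreeStabilityPreservers
import HarnessLib

/-!
# The master composition theorem (Borcea–Brändén II, Corollary 3.4 (a)) for every number of variables

J. Borcea, P. Brändén, *The Lee–Yang and Pólya–Schur programs. II. Theory of stable polynomials and
applications*, Comm. Pure Appl. Math. 62 (2009) 1595–1631 (arXiv:0809.3087), §3:

> **Corollary 3.4.** Let `κ ∈ ℕⁿ` and `f, g ∈ ℂ[z_1,…,z_n,w_1,…,w_n]` be of the form
> `f(z,w) = Σ_{α ≤ κ} binom(κ,α) P_α(w) z^α`, `g(z,w) = Σ_{α ≤ κ} binom(κ,α) Q_α(z) w^α`.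
> (a) If `f` and `g` are `H_θ`-stable for some `0 ≤ θ < 2π`, then so is the polynomial
> `Σ_{α ≤ κ} binom(κ,α) P_α(w) Q_{κ-α}(z)` …
>
> *Proof.* Let `T : ℂ_β[z] → ℂ_κ[z]` and `S : ℂ_κ[z] → ℂ_γ[z]` be the linear operators whose algebraic symbols
> are `f`, respectively `g` … both `S` and `T` preserve stability, hence so does their composition `ST` whose
> symbol is precisely the polynomial in (a). Applying Theorem 3.1 again we conclude that this polynomial is
> stable unless it is of the form `A(z)B(w)` … by exchanging the roles of `f` and `g` we get that `B(w)`,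
> thus also `A(z)B(w)`, must be stable.

This file proves part (a) for `H_θ = ℋ` (the upper half-plane), **every finite set of variables `τ`** and
every `κ` with `κ_i ≥ 1`, from Borcea–Brändén I, Theorem 1.1 in full generality (tree
`BorceaBranden_stabilityPreserver_iff`, `BoundedDegreeStabilityPreservers.lean`), following the printed proof
word for word: `mvSlotOp κ Q` is `S` (`z^α ↦ Q_{κ-α}`, symbol `g`), `mvOpOf β κ P (z^α ↦ z^α)` is `T`
(symbol `f`), `ST = mvOpOf β κ P (z^α ↦ S z^α)` has symbol `h` (`comp_mvOpOf`, `symbol_mvOpOf`), the rank-one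
alternative gives `h = A(z)B(w)` (`boundedDegreeSymbol_of_rankOne`), and the exchange `z ↔ w`
(`rename Sum.swap`) finishes the argument. As in Theorem 3.3 (a) of the paper the conclusion reads "stable or
identically zero" (`κ = 1`, `f = z`, `g = w` give `h = 0`). The two-variable case with `κ = 0` allowed is
`MasterComposition.lean`.

## Contents

* §1 `toF`, `mem_box_iff`, `prod_X_pow_eq_monomial_toF`, `eq_sum_box`, `rename_eq_sum_reflect` (coefficient
  expansions over the box `α ≤ β`).
* §2 `mvCompositionF`, `mvCompositionG`, `mvComposition` (`f`, `g`, `h`) and their behaviour under `z ↔ w`.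
* §3 `mvOpOf` (+ `comp_mvOpOf`, `degreeOf_mvOpOf_le`, **`symbol_mvOpOf`**), `mvSlotOp` (+ `symbol_mvSlotOp`),
  `boundedDegreeSymbol_of_rankOne`.
* §4 `mv_master_composition_pass`, **`mv_master_composition`**.

## References

* [BorceaBranden2009II] J. Borcea, P. Brändén, Comm. Pure Appl. Math. 62 (2009) 1595–1631, §3 Thm. 3.1,
  Thm. 3.3 (a), Cor. 3.4 (a) and its proof.
* [BorceaBranden2009] J. Borcea, P. Brändén, Invent. Math. 177 (2009) 541–569, §1.1 Thm. 1.1.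
-/

noncomputable section

open MvPolynomial Finset

namespace Literature.Combinatorics.StablePolynomials

variable {τ : Type*} [Fintype τ] [DecidableEq τ]

/-! ## §1 Coefficient expansions over a box -/

section Box

omit [DecidableEq τ] in
/-- Exponent vectors as finitely supported functions. [cite: BorceaBranden2009II, §1 (multi-index notation
`z^α`, `α ≤ κ`)] -/
def toF (γ : τ → ℕ) : τ →₀ ℕ :=
  Finsupp.equivFunOnFinite.symm γ

omit [DecidableEq τ] in
/-- `toF γ i = γ i`. [cite: BorceaBranden2009II, §1] -/
@[simp] theorem toF_apply (γ : τ → ℕ) (i : τ) : toF γ i = γ i :=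
  rfl

omit [DecidableEq τ] in
/-- `toF ⇑s = s`. [cite: BorceaBranden2009II, §1] -/
theorem toF_coe (s : τ →₀ ℕ) : toF (⇑s) = s :=
  Finsupp.equivFunOnFinite_symm_coe s

omit [Fintype τ] in
/-- Membership in the box `{α : α ≤ κ}`. [cite: BorceaBranden2009II, §1 (`α ≤ κ`)] -/
theorem mem_box_iff [Fintype τ] {κ m : τ → ℕ} :
    m ∈ Fintype.piFinset (fun i => range (κ i + 1)) ↔ ∀ i, m i ≤ κ i := by
  rw [Fintype.mem_piFinset]
  exact forall_congr' fun i => by rw [mem_range, Nat.lt_succ_iff]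

omit [DecidableEq τ] in
/-- `z^m` is the monomial `toF m`. [cite: BorceaBranden2009II, §1 (`z^α = Π z_i^{α_i}`)] -/
theorem prod_X_pow_eq_monomial_toF (m : τ → ℕ) : (∏ i, X i ^ m i : MvPolynomial τ ℂ) = monomial (toF m) 1 := by
  rw [monomial_eq, C_1, one_mul, Finsupp.prod_fintype _ _ fun i => pow_zero _]
  rfl

omit [DecidableEq τ] in
/-- `deg_{z_i} z^m = m_i`. [cite: BorceaBranden2009II, §1] -/
theorem degreeOf_prod_X_pow (m : τ → ℕ) (i : τ) : degreeOf i (∏ j, X j ^ m j : MvPolynomial τ ℂ) = m i := by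
  rw [prod_X_pow_eq_monomial_toF, degreeOf_monomial_eq _ _ one_ne_zero]
  rfl

/-- **A polynomial of `ℂ_β[z_τ]` is the sum of its coefficients over the box `m ≤ β`.**
[cite: BorceaBranden2009II, §1 (the space `ℂ_κ[z]`)] -/
theorem eq_sum_box {β : τ → ℕ} {p : MvPolynomial τ ℂ} (hp : ∀ i, degreeOf i p ≤ β i) :
    p = ∑ m ∈ Fintype.piFinset (fun i => range (β i + 1)), coeff (toF m) p • ∏ i, (X i : MvPolynomial τ ℂ) ^ m i := by
  have hsub : p.support ⊆ (Fintype.piFinset fun i => range (β i + 1)).image toF := by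
    intro s hs
    exact mem_image.2 ⟨⇑s, mem_box_iff.2 fun i => (monomial_le_degreeOf i hs).trans (hp i), toF_coe s⟩
  have hinj : Set.InjOn (toF : (τ → ℕ) → τ →₀ ℕ) ↑(Fintype.piFinset fun i => range (β i + 1)) :=
    fun m _ m' _ h => funext fun i => by rw [← toF_apply m i, h, toF_apply]
  calc p = ∑ s ∈ p.support, monomial s (coeff s p) := p.as_sum
    _ = ∑ s ∈ (Fintype.piFinset fun i => range (β i + 1)).image toF, monomial s (coeff s p) :=
        sum_subset hsub fun s _ hs => by rw [notMem_support_iff.1 hs, map_zero]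
    _ = ∑ m ∈ Fintype.piFinset (fun i => range (β i + 1)), monomial (toF m) (coeff (toF m) p) := sum_image hinj
    _ = _ := sum_congr rfl fun m _ => by rw [prod_X_pow_eq_monomial_toF, smul_monomial, smul_eq_mul, mul_one]

/-- **`ι(p) = Σ_{m ≤ β} [z^{β-m}]p · z^{β-m}`** (renamed variables, reflected box) for `p ∈ ℂ_β[z_τ]`.
[cite: BorceaBranden2009II, §1] -/
theorem rename_eq_sum_reflect {σ' : Type*} (e : τ → σ') {β : τ → ℕ} {p : MvPolynomial τ ℂ}
    (hp : ∀ i, degreeOf i p ≤ β i) :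
    rename e p = ∑ m ∈ Fintype.piFinset (fun i => range (β i + 1)),
      coeff (toF (β - m)) p • ∏ i, (X (e i) : MvPolynomial σ' ℂ) ^ (β i - m i) := by
  conv_lhs => rw [eq_sum_box hp, map_sum]
  symm
  refine sum_nbij' (fun m => β - m) (fun m => β - m) (fun m _ => mem_box_iff.2 fun i => Nat.sub_le _ _)
    (fun m _ => mem_box_iff.2 fun i => Nat.sub_le _ _)
    (fun m hm => funext fun i => ?_) (fun m hm => funext fun i => ?_) fun m _ => ?_
  · simp only [Pi.sub_apply, Nat.sub_sub_self (mem_box_iff.1 hm i)]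
  · simp only [Pi.sub_apply, Nat.sub_sub_self (mem_box_iff.1 hm i)]
  · rw [smul_eq_C_mul, smul_eq_C_mul, _root_.map_mul, rename_C, _root_.map_prod]
    simp only [_root_.map_pow, rename_X, Pi.sub_apply]

end Box

/-! ## §2 The three polynomials and the exchange `z ↔ w` -/

section Polys

/-- **`f(z,w) = Σ_{α ≤ κ} binom(κ,α) P_α(w) z^α`** (`z_i = X (inl i)`, `w_i = X (inr i)`).
[cite: BorceaBranden2009II, §3 Cor. 3.4] -/
def mvCompositionF (κ : τ → ℕ) (P : (τ → ℕ) → MvPolynomial τ ℂ) : MvPolynomial (τ ⊕ τ) ℂ :=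
  ∑ α ∈ Fintype.piFinset (fun i => range (κ i + 1)),
    (∏ i, (((κ i).choose (α i) : ℕ) : ℂ)) • ((∏ i, X (Sum.inl i) ^ α i) * rename Sum.inr (P α))

/-- **`g(z,w) = Σ_{α ≤ κ} binom(κ,α) Q_α(z) w^α`.** [cite: BorceaBranden2009II, §3 Cor. 3.4] -/
def mvCompositionG (κ : τ → ℕ) (Q : (τ → ℕ) → MvPolynomial τ ℂ) : MvPolynomial (τ ⊕ τ) ℂ :=
  ∑ α ∈ Fintype.piFinset (fun i => range (κ i + 1)),
    (∏ i, (((κ i).choose (α i) : ℕ) : ℂ)) • (rename Sum.inl (Q α) * ∏ i, X (Sum.inr i) ^ α i)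

/-- **`h(z,w) = Σ_{α ≤ κ} binom(κ,α) P_α(w) Q_{κ-α}(z)`.** [cite: BorceaBranden2009II, §3 Cor. 3.4 (a)] -/
def mvComposition (κ : τ → ℕ) (P Q : (τ → ℕ) → MvPolynomial τ ℂ) : MvPolynomial (τ ⊕ τ) ℂ :=
  ∑ α ∈ Fintype.piFinset (fun i => range (κ i + 1)),
    (∏ i, (((κ i).choose (α i) : ℕ) : ℂ)) • (rename Sum.inl (Q (κ - α)) * rename Sum.inr (P α))

omit [Fintype τ] [DecidableEq τ] in
/-- `z ↔ w` on `ι_z`. [cite: BorceaBranden2009II, §3 proof of Cor. 3.4 ("exchanging the roles of f and g")] -/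
private theorem rename_swap_rename_inl (q : MvPolynomial τ ℂ) :
    rename Sum.swap (rename Sum.inl q) = (rename Sum.inr q : MvPolynomial (τ ⊕ τ) ℂ) := by
  rw [rename_rename]
  rfl

omit [Fintype τ] [DecidableEq τ] in
/-- `z ↔ w` on `ι_w`. [cite: BorceaBranden2009II, §3 proof of Cor. 3.4] -/
private theorem rename_swap_rename_inr (q : MvPolynomial τ ℂ) :
    rename Sum.swap (rename Sum.inr q) = (rename Sum.inl q : MvPolynomial (τ ⊕ τ) ℂ) := by
  rw [rename_rename]
  rfl

/-- Exchanging `z` and `w` turns `g` into `f` (with `Q` for `P`). [cite: BorceaBranden2009II, §3 proof of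
Cor. 3.4 ("by exchanging the roles of `f` and `g`")] -/
theorem rename_swap_mvCompositionG (κ : τ → ℕ) (Q : (τ → ℕ) → MvPolynomial τ ℂ) :
    rename Sum.swap (mvCompositionG κ Q) = mvCompositionF κ Q := by
  rw [mvCompositionG, mvCompositionF, map_sum]
  refine sum_congr rfl fun α _ => ?_
  rw [map_smul, _root_.map_mul, rename_swap_rename_inl,
    _root_.map_prod (rename Sum.swap : MvPolynomial (τ ⊕ τ) ℂ →ₐ[ℂ] MvPolynomial (τ ⊕ τ) ℂ),
    mul_comm (rename Sum.inr (Q α))]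
  simp only [_root_.map_pow, rename_X, Sum.swap_inr]

/-- Exchanging `z` and `w` turns `f` into `g`. [cite: BorceaBranden2009II, §3 proof of Cor. 3.4] -/
theorem rename_swap_mvCompositionF (κ : τ → ℕ) (P : (τ → ℕ) → MvPolynomial τ ℂ) :
    rename Sum.swap (mvCompositionF κ P) = mvCompositionG κ P := by
  rw [mvCompositionG, mvCompositionF, map_sum]
  refine sum_congr rfl fun α _ => ?_
  rw [map_smul, _root_.map_mul, rename_swap_rename_inr,
    _root_.map_prod (rename Sum.swap : MvPolynomial (τ ⊕ τ) ℂ →ₐ[ℂ] MvPolynomial (τ ⊕ τ) ℂ),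
    mul_comm (rename Sum.inl (P α))]
  simp only [_root_.map_pow, rename_X, Sum.swap_inl]

/-- Exchanging `z` and `w` (and `P`, `Q`) preserves `h`. [cite: BorceaBranden2009II, §3 proof of Cor. 3.4] -/
theorem rename_swap_mvComposition (κ : τ → ℕ) (P Q : (τ → ℕ) → MvPolynomial τ ℂ) :
    rename Sum.swap (mvComposition κ P Q) = mvComposition κ Q P := by
  rw [mvComposition, mvComposition, map_sum]
  refine sum_nbij' (fun m => κ - m) (fun m => κ - m) (fun m _ => mem_box_iff.2 fun i => Nat.sub_le _ _)
    (fun m _ => mem_box_iff.2 fun i => Nat.sub_le _ _)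
    (fun m hm => funext fun i => ?_) (fun m hm => funext fun i => ?_) fun m hm => ?_
  · simp only [Pi.sub_apply, Nat.sub_sub_self (mem_box_iff.1 hm i)]
  · simp only [Pi.sub_apply, Nat.sub_sub_self (mem_box_iff.1 hm i)]
  · have hm' := mem_box_iff.1 hm
    have hmm : κ - (κ - m) = m := funext fun i => by simp only [Pi.sub_apply, Nat.sub_sub_self (hm' i)]
    rw [hmm, smul_eq_C_mul, smul_eq_C_mul, _root_.map_mul, rename_C, _root_.map_mul, rename_swap_rename_inl,
      rename_swap_rename_inr, mul_comm (rename Sum.inr (Q (κ - m)))]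
    congr 2
    refine prod_congr rfl fun i _ => ?_
    rw [Pi.sub_apply, Nat.choose_symm (hm' i)]

end Polys

/-! ## §3 Operators with prescribed symbols -/

section Operators

/-- **The operator `T` with symbol `f`**, parametrised by the images `R_α` of the slots `α ≤ κ`:
`z^m ↦ binom(β,m)⁻¹ Σ_{α≤κ} binom(κ,α) [w^{β-m}]P_α · R_α` for `m ≤ β`, and `0` outside the box.
[cite: BorceaBranden2009II, §3 proof of Cor. 3.4 ("the linear operators whose algebraic symbols … are `f`,
respectively `g`")] -/
def mvOpOf (β κ : τ → ℕ) (P R : (τ → ℕ) → MvPolynomial τ ℂ) : MvPolynomial τ ℂ →ₗ[ℂ] MvPolynomial τ ℂ :=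
  (basisMonomials τ ℂ).constr ℂ fun s =>
    if ∀ i, s i ≤ β i then
      (∏ i, (((β i).choose (s i) : ℕ) : ℂ))⁻¹ •
        ∑ α ∈ Fintype.piFinset (fun i => range (κ i + 1)),
          ((∏ i, (((κ i).choose (α i) : ℕ) : ℂ)) * coeff (toF (β - ⇑s)) (P α)) • R α
    else 0

/-- `mvOpOf` on `z^m`, `m ≤ β`. [cite: BorceaBranden2009II, §3 proof of Cor. 3.4] -/
theorem mvOpOf_prod_X_pow {β κ : τ → ℕ} {P R : (τ → ℕ) → MvPolynomial τ ℂ} {m : τ → ℕ} (hm : ∀ i, m i ≤ β i) :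
    mvOpOf β κ P R (∏ i, X i ^ m i) =
      (∏ i, (((β i).choose (m i) : ℕ) : ℂ))⁻¹ •
        ∑ α ∈ Fintype.piFinset (fun i => range (κ i + 1)),
          ((∏ i, (((κ i).choose (α i) : ℕ) : ℂ)) * coeff (toF (β - m)) (P α)) • R α := by
  rw [prod_X_pow_eq_monomial_toF, show (monomial (toF m) (1 : ℂ)) = basisMonomials τ ℂ (toF m) by
    rw [coe_basisMonomials], mvOpOf, Module.Basis.constr_basis,
    if_pos (show ∀ i, (toF m) i ≤ β i from fun i => hm i)]
  rfl

/-- `mvOpOf` on `z^m`, `m ≰ β`. [cite: BorceaBranden2009II, §3 proof of Cor. 3.4] -/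
theorem mvOpOf_prod_X_pow_of_not {β κ : τ → ℕ} {P R : (τ → ℕ) → MvPolynomial τ ℂ} {m : τ → ℕ}
    (hm : ¬∀ i, m i ≤ β i) : mvOpOf β κ P R (∏ i, X i ^ m i) = 0 := by
  rw [prod_X_pow_eq_monomial_toF, show (monomial (toF m) (1 : ℂ)) = basisMonomials τ ℂ (toF m) by
    rw [coe_basisMonomials], mvOpOf, Module.Basis.constr_basis,
    if_neg (show ¬∀ i, (toF m) i ≤ β i from fun h => hm fun i => h i)]

/-- **Composition replaces the slots**: `S ∘ mvOpOf(R) = mvOpOf(S ∘ R)`. [cite: BorceaBranden2009II, §3 proof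
of Cor. 3.4 ("their composition `ST`")] -/
theorem comp_mvOpOf (β κ : τ → ℕ) (P R : (τ → ℕ) → MvPolynomial τ ℂ)
    (S : MvPolynomial τ ℂ →ₗ[ℂ] MvPolynomial τ ℂ) :
    S ∘ₗ mvOpOf β κ P R = mvOpOf β κ P fun α => S (R α) := by
  refine (basisMonomials τ ℂ).ext fun s => ?_
  rw [LinearMap.comp_apply, coe_basisMonomials]
  show S (mvOpOf β κ P R (monomial s 1)) = mvOpOf β κ P (fun α => S (R α)) (monomial s 1)
  rw [← toF_coe s, ← prod_X_pow_eq_monomial_toF]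
  by_cases hs : ∀ i, s i ≤ β i
  · rw [mvOpOf_prod_X_pow hs, mvOpOf_prod_X_pow hs, map_smul, map_sum]
    simp only [map_smul]
  · rw [mvOpOf_prod_X_pow_of_not hs, mvOpOf_prod_X_pow_of_not hs, map_zero]

/-- Values of `mvOpOf` lie in `ℂ_N[z_τ]` when all slots do. [cite: BorceaBranden2009II, §3 proof of Cor. 3.4
(`T : ℂ_β[z] → ℂ_κ[z]`)] -/
theorem degreeOf_mvOpOf_le {β κ N : τ → ℕ} {P R : (τ → ℕ) → MvPolynomial τ ℂ}
    (hR : ∀ α ∈ Fintype.piFinset (fun i => range (κ i + 1)), ∀ i, degreeOf i (R α) ≤ N i)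
    (p : MvPolynomial τ ℂ) (i : τ) : degreeOf i (mvOpOf β κ P R p) ≤ N i := by
  have hm : ∀ m : τ → ℕ, degreeOf i (mvOpOf β κ P R (∏ j, X j ^ m j)) ≤ N i := by
    intro m
    by_cases h : ∀ j, m j ≤ β j
    · rw [mvOpOf_prod_X_pow h, smul_eq_C_mul]
      refine (degreeOf_C_mul_le _ _ _).trans ((degreeOf_sum_le _ _ _).trans (Finset.sup_le fun α hα => ?_))
      rw [smul_eq_C_mul]
      exact (degreeOf_C_mul_le _ _ _).trans (hR α hα i)
    · rw [mvOpOf_prod_X_pow_of_not h, degreeOf_zero]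
      exact Nat.zero_le _
  have hp : p = ∑ s ∈ p.support, coeff s p • ∏ j, (X j : MvPolynomial τ ℂ) ^ (s : τ → ℕ) j := by
    conv_lhs => rw [p.as_sum]
    refine sum_congr rfl fun s _ => ?_
    rw [prod_X_pow_eq_monomial_toF, toF_coe, smul_monomial, smul_eq_mul, mul_one]
  rw [hp, map_sum]
  refine (degreeOf_sum_le _ _ _).trans (Finset.sup_le fun s _ => ?_)
  rw [map_smul, smul_eq_C_mul]
  exact (degreeOf_C_mul_le _ _ _).trans (hm _)

/-- **The symbol of `mvOpOf`**: `G_{mvOpOf(R)}(z,w) = Σ_{α≤κ} binom(κ,α) R_α(z) P_α(w)` on `ℂ_β[z_τ]` when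
`P_α ∈ ℂ_β[w]` — for `R_α = z^α` this is `f`, after composing with `S` it is `h`.
[cite: BorceaBranden2009II, §3 proof of Cor. 3.4 ("whose symbol is precisely the polynomial in (a)")] -/
theorem symbol_mvOpOf {β κ : τ → ℕ} {P : (τ → ℕ) → MvPolynomial τ ℂ}
    (hP : ∀ α ∈ Fintype.piFinset (fun i => range (κ i + 1)), ∀ i, degreeOf i (P α) ≤ β i)
    (R : (τ → ℕ) → MvPolynomial τ ℂ) :
    boundedDegreeSymbol β (mvOpOf β κ P R) =
      ∑ α ∈ Fintype.piFinset (fun i => range (κ i + 1)),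
        (∏ i, (((κ i).choose (α i) : ℕ) : ℂ)) • (rename Sum.inl (R α) * rename Sum.inr (P α)) := by
  have h1 : ∀ m ∈ Fintype.piFinset (fun i => range (β i + 1)),
      (∏ i, (((β i).choose (m i) : ℕ) : ℂ)) •
        (rename Sum.inl (mvOpOf β κ P R (∏ i, X i ^ m i)) * ∏ i, (X (Sum.inr i) : MvPolynomial (τ ⊕ τ) ℂ) ^ (β i - m i)) =
      ∑ α ∈ Fintype.piFinset (fun i => range (κ i + 1)),
        ((∏ i, (((κ i).choose (α i) : ℕ) : ℂ)) * coeff (toF (β - m)) (P α)) •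
          (rename Sum.inl (R α) * ∏ i, (X (Sum.inr i) : MvPolynomial (τ ⊕ τ) ℂ) ^ (β i - m i)) := by
    intro m hm
    have hm' := mem_box_iff.1 hm
    have hne : (∏ i, (((β i).choose (m i) : ℕ) : ℂ)) ≠ 0 :=
      prod_ne_zero_iff.2 fun i _ => Nat.cast_ne_zero.2 (Nat.choose_pos (hm' i)).ne'
    rw [mvOpOf_prod_X_pow hm', map_smul, map_sum, smul_mul_assoc, smul_smul, mul_inv_cancel₀ hne, one_smul,
      sum_mul]
    refine sum_congr rfl fun α _ => ?_
    rw [map_smul, smul_mul_assoc]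
  rw [boundedDegreeSymbol, sum_congr rfl h1, sum_comm]
  refine sum_congr rfl fun α hα => ?_
  rw [rename_eq_sum_reflect Sum.inr (hP α hα), mul_sum, smul_sum]
  refine sum_congr rfl fun m _ => ?_
  rw [mul_smul_comm, smul_smul]

/-- **The operator `S` with symbol `g`**: `z^m ↦ Q_{κ-m}` (`m ≤ κ`). [cite: BorceaBranden2009II, §3 proof of
Cor. 3.4] -/
def mvSlotOp (κ : τ → ℕ) (Q : (τ → ℕ) → MvPolynomial τ ℂ) : MvPolynomial τ ℂ →ₗ[ℂ] MvPolynomial τ ℂ :=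
  (basisMonomials τ ℂ).constr ℂ fun s => if ∀ i, s i ≤ κ i then Q (κ - ⇑s) else 0

omit [DecidableEq τ] in
/-- `S(z^m) = Q_{κ-m}` for `m ≤ κ`. [cite: BorceaBranden2009II, §3 proof of Cor. 3.4] -/
theorem mvSlotOp_prod_X_pow {κ : τ → ℕ} (Q : (τ → ℕ) → MvPolynomial τ ℂ) {m : τ → ℕ} (hm : ∀ i, m i ≤ κ i) :
    mvSlotOp κ Q (∏ i, X i ^ m i) = Q (κ - m) := by
  rw [prod_X_pow_eq_monomial_toF, show (monomial (toF m) (1 : ℂ)) = basisMonomials τ ℂ (toF m) by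
    rw [coe_basisMonomials], mvSlotOp, Module.Basis.constr_basis,
    if_pos (show ∀ i, (toF m) i ≤ κ i from fun i => hm i)]
  rfl

/-- **The symbol of `S` on `ℂ_κ[z_τ]` is `g`.** [cite: BorceaBranden2009II, §3 proof of Cor. 3.4] -/
theorem symbol_mvSlotOp (κ : τ → ℕ) (Q : (τ → ℕ) → MvPolynomial τ ℂ) :
    boundedDegreeSymbol κ (mvSlotOp κ Q) = mvCompositionG κ Q := by
  rw [boundedDegreeSymbol, mvCompositionG]
  symm
  refine sum_nbij' (fun m => κ - m) (fun m => κ - m) (fun m _ => mem_box_iff.2 fun i => Nat.sub_le _ _)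
    (fun m _ => mem_box_iff.2 fun i => Nat.sub_le _ _)
    (fun m hm => funext fun i => ?_) (fun m hm => funext fun i => ?_) fun m hm => ?_
  · simp only [Pi.sub_apply, Nat.sub_sub_self (mem_box_iff.1 hm i)]
  · simp only [Pi.sub_apply, Nat.sub_sub_self (mem_box_iff.1 hm i)]
  · have hm' := mem_box_iff.1 hm
    have hmm : κ - (κ - m) = m := funext fun i => by simp only [Pi.sub_apply, Nat.sub_sub_self (hm' i)]
    rw [mvSlotOp_prod_X_pow Q (show ∀ i, (κ - m) i ≤ κ i from fun i => Nat.sub_le _ _), hmm]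
    congr 1
    · refine prod_congr rfl fun i _ => ?_
      rw [Pi.sub_apply, Nat.choose_symm (hm' i)]
    · congr 1
      refine prod_congr rfl fun i _ => ?_
      rw [Pi.sub_apply, Nat.sub_sub_self (hm' i)]

/-- **The symbol of a rank-one operator factorises**: if `L(z^m) = a_m A` for `m ≤ β` then
`G_L(z,w) = A(z)·B(w)` with `B = Σ_m binom(β,m) a_m w^{β-m}`. [cite: BorceaBranden2009II, §3 proof of
Cor. 3.4 ("unless it is of the form `A(z)B(w)`")] -/
theorem boundedDegreeSymbol_of_rankOne {β : τ → ℕ} {L : MvPolynomial τ ℂ →ₗ[ℂ] MvPolynomial τ ℂ}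
    {a : (τ → ℕ) → ℂ} {A : MvPolynomial τ ℂ}
    (h : ∀ m ∈ Fintype.piFinset (fun i => range (β i + 1)), L (∏ i, X i ^ m i) = a m • A) :
    boundedDegreeSymbol β L = rename Sum.inl A *
      rename Sum.inr (∑ m ∈ Fintype.piFinset (fun i => range (β i + 1)),
        ((∏ i, (((β i).choose (m i) : ℕ) : ℂ)) * a m) • ∏ i, (X i : MvPolynomial τ ℂ) ^ (β i - m i)) := by
  rw [map_sum, boundedDegreeSymbol, mul_sum]
  refine sum_congr rfl fun m hm => ?_
  rw [h m hm, map_smul, map_smul, _root_.map_prod]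
  simp only [_root_.map_pow, rename_X]
  rw [smul_mul_assoc, smul_smul, mul_smul_comm]

end Operators

/-! ## §4 The master composition theorem -/

section Main

omit [Fintype τ] [DecidableEq τ] in
/-- Substituting constants: `p(C c, …, C c) = C(p(c,…,c))`. [folklore] -/
private theorem aeval_const_C (c : ℂ) (p : MvPolynomial τ ℂ) :
    aeval (fun _ : τ => (C c : MvPolynomial τ ℂ)) p = C (eval (fun _ => c) p) := by
  induction p using MvPolynomial.induction_on with
  | C a => rw [aeval_C, eval_C, algebraMap_eq]
  | add p q hp hq => rw [map_add, map_add, hp, hq, map_add]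
  | mul_X p i hp => rw [_root_.map_mul, aeval_X, hp, _root_.map_mul, eval_X, _root_.map_mul]

/-- **One pass of the printed argument** (`κ_i ≥ 1`): if `f` and `g` are stable then `h` is stable, or
`h = A(z)B(w)` with `A` stable (the rank-one alternative of Theorem 1.1 for `ST`).
[cite: BorceaBranden2009II, §3 proof of Cor. 3.4] [cite: BorceaBranden2009, §1.1 Thm. 1.1] -/
theorem mv_master_composition_pass {κ : τ → ℕ} (hκ : ∀ i, 0 < κ i) (P Q : (τ → ℕ) → MvPolynomial τ ℂ)
    (hf : IsUpperHalfPlaneStable (mvCompositionF κ P)) (hg : IsUpperHalfPlaneStable (mvCompositionG κ Q)) :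
    IsUpperHalfPlaneStable (mvComposition κ P Q) ∨
      ∃ A B : MvPolynomial τ ℂ, IsUpperHalfPlaneStable A ∧
        mvComposition κ P Q = rename Sum.inl A * rename Sum.inr B := by
  -- a common degree box `β ≥ 1` for the `P_α`
  set β : τ → ℕ := fun i =>
    max 1 ((Fintype.piFinset fun j => range (κ j + 1)).sup fun α => degreeOf i (P α)) with hβ
  have hβ1 : ∀ i, 0 < β i := fun i => lt_of_lt_of_le Nat.one_pos (le_max_left _ _)
  have hP : ∀ α ∈ Fintype.piFinset (fun j => range (κ j + 1)), ∀ i, degreeOf i (P α) ≤ β i := fun α hα i =>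
    (Finset.le_sup (f := fun α => degreeOf i (P α)) hα).trans (le_max_right _ _)
  -- `S` preserves stability on `ℂ_κ[z]` (its symbol is `g`)
  have hS : ∀ p : MvPolynomial τ ℂ, (∀ i, degreeOf i p ≤ κ i) → IsUpperHalfPlaneStable p →
      IsUpperHalfPlaneStable (mvSlotOp κ Q p) ∨ mvSlotOp κ Q p = 0 :=
    (BorceaBranden_stabilityPreserver_iff hκ (mvSlotOp κ Q)).2 (Or.inr (by rw [symbol_mvSlotOp]; exact hg))
  -- `T` preserves stability on `ℂ_β[z]` (its symbol is `f`) and maps into `ℂ_κ[z]`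
  set T := mvOpOf β κ P fun α => ∏ i, X i ^ α i with hT
  have hTsymb : boundedDegreeSymbol β T = mvCompositionF κ P := by
    rw [hT, symbol_mvOpOf hP, mvCompositionF]
    refine sum_congr rfl fun α _ => ?_
    rw [_root_.map_prod]
    simp only [_root_.map_pow, rename_X]
  have hTpres : ∀ p : MvPolynomial τ ℂ, (∀ i, degreeOf i p ≤ β i) → IsUpperHalfPlaneStable p →
      IsUpperHalfPlaneStable (T p) ∨ T p = 0 :=
    (BorceaBranden_stabilityPreserver_iff hβ1 T).2 (Or.inr (by rw [hTsymb]; exact hf))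
  have hTdeg : ∀ p : MvPolynomial τ ℂ, ∀ i, degreeOf i (T p) ≤ κ i := fun p i =>
    degreeOf_mvOpOf_le (fun α hα j => by rw [degreeOf_prod_X_pow]; exact mem_box_iff.1 hα j) p i
  -- `ST` preserves stability on `ℂ_β[z]`
  have hST : ∀ p : MvPolynomial τ ℂ, (∀ i, degreeOf i p ≤ β i) → IsUpperHalfPlaneStable p →
      IsUpperHalfPlaneStable ((mvSlotOp κ Q ∘ₗ T) p) ∨ (mvSlotOp κ Q ∘ₗ T) p = 0 := by
    intro p hp hs
    rw [LinearMap.comp_apply]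
    rcases hTpres p hp hs with h | h
    · exact hS _ (hTdeg p) h
    · exact Or.inr (by rw [h, map_zero])
  -- the symbol of `ST` is `h`
  have hSTsymb : boundedDegreeSymbol β (mvSlotOp κ Q ∘ₗ T) = mvComposition κ P Q := by
    rw [hT, comp_mvOpOf, symbol_mvOpOf hP, mvComposition]
    refine sum_congr rfl fun α hα => ?_
    rw [mvSlotOp_prod_X_pow Q (mem_box_iff.1 hα)]
  -- Theorem 1.1 for `ST`
  rcases (BorceaBranden_stabilityPreserver_iff hβ1 (mvSlotOp κ Q ∘ₗ T)).1 hST with ⟨a, A, hA, haA⟩ | hG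
  · right
    refine ⟨A, ∑ m ∈ Fintype.piFinset (fun i => range (β i + 1)),
      ((∏ i, (((β i).choose (m i) : ℕ) : ℂ)) * a (∏ i, X i ^ m i)) • ∏ i, (X i : MvPolynomial τ ℂ) ^ (β i - m i),
      hA, ?_⟩
    rw [← hSTsymb]
    exact boundedDegreeSymbol_of_rankOne fun m hm =>
      haA _ fun i => by rw [degreeOf_prod_X_pow]; exact mem_box_iff.1 hm i
  · left
    rwa [hSTsymb] at hG

/-- **The master composition theorem (Borcea–Brändén II, Cor. 3.4 (a)) for `H_θ = ℋ`, every number of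
variables and every `κ` with `κ_i ≥ 1`.** If `f(z,w) = Σ_{α≤κ} binom(κ,α) P_α(w) z^α` and
`g(z,w) = Σ_{α≤κ} binom(κ,α) Q_α(z) w^α` are stable, then `h(z,w) = Σ_{α≤κ} binom(κ,α) P_α(w) Q_{κ-α}(z)` is
stable or identically zero. [cite: BorceaBranden2009II, §3 Cor. 3.4 (a) and its proof; Thm. 3.3 (a) for the
alternative "or identically zero"] -/
theorem mv_master_composition {κ : τ → ℕ} (hκ : ∀ i, 0 < κ i) (P Q : (τ → ℕ) → MvPolynomial τ ℂ)
    (hf : IsUpperHalfPlaneStable (mvCompositionF κ P)) (hg : IsUpperHalfPlaneStable (mvCompositionG κ Q)) :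
    mvComposition κ P Q = 0 ∨ IsUpperHalfPlaneStable (mvComposition κ P Q) := by
  -- the data with `z ↔ w`, `f ↔ g`
  have hf' : IsUpperHalfPlaneStable (mvCompositionF κ Q) := by
    rw [← rename_swap_mvCompositionG]
    exact isUpperHalfPlaneStable_rename_fiberMap Sum.swap hg
  have hg' : IsUpperHalfPlaneStable (mvCompositionG κ P) := by
    rw [← rename_swap_mvCompositionF]
    exact isUpperHalfPlaneStable_rename_fiberMap Sum.swap hf
  rcases mv_master_composition_pass hκ P Q hf hg with h1 | ⟨A, B, hA, hAB⟩
  · exact Or.inr h1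
  rcases mv_master_composition_pass hκ Q P hf' hg' with h2 | ⟨A', B', hA', hAB'⟩
  · refine Or.inr ?_
    rw [← rename_swap_mvComposition] at h2
    have h3 := isUpperHalfPlaneStable_rename_fiberMap Sum.swap h2
    rwa [rename_rename, Sum.swap_swap_eq, rename_id] at h3
  -- both passes give product forms: `A(z)B(w) = B'(z)A'(w)`
  have hprod : rename Sum.inl A * rename Sum.inr B =
      (rename Sum.inl B' * rename Sum.inr A' : MvPolynomial (τ ⊕ τ) ℂ) := by
    rw [← hAB, ← rename_swap_mvComposition κ Q P, hAB', _root_.map_mul, rename_swap_rename_inl,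
      rename_swap_rename_inr, mul_comm]
  by_cases hB : B = 0
  · left
    rw [hAB, hB, map_zero, mul_zero]
  · right
    -- specialise `z = (i,…,i)`: `A(i) B = B'(i) A'`
    have hAI : eval (fun _ : τ => Complex.I) A ≠ 0 := hA _ fun _ => by simp
    have hspec : C (eval (fun _ : τ => Complex.I) A) * B = C (eval (fun _ : τ => Complex.I) B') * A' := by
      have h := congrArg (MvPolynomial.aeval (Sum.elim (fun _ : τ => (C Complex.I : MvPolynomial τ ℂ)) X)) hprod
      simp only [_root_.map_mul, aeval_rename, Sum.elim_comp_inl, Sum.elim_comp_inr, aeval_X_left_apply] at h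
      rwa [aeval_const_C, aeval_const_C] at h
    have hB'I : eval (fun _ : τ => Complex.I) B' ≠ 0 := by
      intro h0
      rw [h0, map_zero, zero_mul, mul_eq_zero] at hspec
      rcases hspec with h | h
      · exact hAI (C_eq_zero.1 h)
      · exact hB h
    have hBeq : B = C (eval (fun _ : τ => Complex.I) B' / eval (fun _ : τ => Complex.I) A) * A' := by
      rw [div_eq_mul_inv, mul_comm (eval _ B'), C_mul, mul_assoc, ← hspec, ← mul_assoc, ← C_mul,
        inv_mul_cancel₀ hAI, C_1, one_mul]
    have hBs : IsUpperHalfPlaneStable B := fun w hw => by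
      rw [hBeq, _root_.map_mul, eval_C]
      exact mul_ne_zero (div_ne_zero hB'I hAI) (hA' w hw)
    rw [hAB]
    exact (isUpperHalfPlaneStable_rename_fiberMap Sum.inl hA).mul (isUpperHalfPlaneStable_rename_fiberMap Sum.inr hBs)

end Main

end Literature.Combinatorics.StablePolynomials

end
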